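import Summits.QuantumAdvantage.AdviceFreeQNC0.WalkTransport
import Mathlib.Analysis.SpecificLimits.Basic
import HarnessLib

/-!
# Cell qa-qnc0 / decomp-qadv (odd primes): junta ⊕ linear-form strategy DATA, privacy, freezing and the peeling induction

TREE-READY PART 1/3 of the node `HOME/decomp-qadv-lens-6/g9/PeelDial.lean` (decomp-qadv-lens-6 g9, §1, §2, §5, §6),
ZERO `def … : Prop` (the node's predicates `JuntaBound` / `IsCore` / `IsExclusive` are spelled out in every statement).

The object: explicit strategy DATA `D : JLinData p n` for α's u-walk game (tree `ringWinU`) — cut `g` reads a junta `J g`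
of input bits and ONE `𝔽_p`-linear form `u ↦ Σ_{i : u i} a g i` and answers by a table `h g` (depending on `u` only
through `J g`).  This is the presentation class of route CharDial's item 32604 `WalkHardFJLinOdd` (⊇ R5 `WalkHardFLinSel`).

* §1 `winCount`, `JLinData` (+ `form`, `strat`, `suppForm`, `readSet`, the PRIVATE bits `privSet g` = bits of `supp (a g)`
  outside `J g` and outside the read-set of every other cut, `priv`, `activeSet`, `freeze g κ` = replace cut `g`'s form
  by the constant `κ`);
* §2 bookkeeping: freezing keeps juntas, empties `g`'s support, shrinks read-sets, can only ENLARGE the privacy of the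
  other cuts (`priv_le_priv_freeze`), removes `g` from the active set (`activeSet_freeze`), and an inactive data is a
  junta strategy (`strat_dependsOn_of_inactive`);
* §5 the PEELING INDUCTION (kernel): `peel_to_core` — given a one-step law «freezing one cut costs `C·ρ^{priv}·2ⁿ`» and a
  bound `θ₁·2ⁿ` on every `L`-CORE (no active cut owns `≥ L` private bits), any data with `≤ m` active cuts wins at most
  `(m·C·ρ^L + θ₁)·2ⁿ`; `peel_exclusive` — the same down to the totally inactive data when every active cut owns `≥ L`
  private bits;
* §6 `succ_mul_mul_pow_log_le`, `peel_error_small`: `(n+1)·C·q^{C'·log₂ n}` is eventually `≤ ε` once `ρ^{C'} ≤ 1/4`.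

Parts 2/3 (`CharDialJLinHybrid.lean`: the one-step law, PROVED) and 3/3 (`CharDialJLinCore.lean`: the exclusive rung,
the reduction of 32604 / R5 to cores, the witness family) build on this file.
-/

namespace Summit.QuantumAdvantage.AdviceFreeQNC0.JLinPeel

open Finset Summit.QuantumAdvantage.AdviceFreeQNC0

/-! ### §1 Win counts and junta-plus-linear-form strategy DATA -/

/-- Number of inputs `u ∈ {0,1}ⁿ` on which the strategy `y` wins α's u-walk game with charge `c`. -/
def winCount {n : ℕ} (c : ℕ) (y : Fin (n + 1) → (Fin n → Bool) → Bool) : ℕ :=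
  (univ.filter fun u : Fin n → Bool => ringWinU c y u = true).card

/-- CharDial sub-characteristic helper `winCount_le` (lens-6 g8 LAND package; see the module docstring). -/
theorem winCount_le {n : ℕ} (c : ℕ) (y : Fin (n + 1) → (Fin n → Bool) → Bool) : winCount c y ≤ 2 ^ n := by
  unfold winCount
  calc (univ.filter fun u : Fin n → Bool => ringWinU c y u = true).card
      ≤ (univ : Finset (Fin n → Bool)).card := card_filter_le _ _
    _ = 2 ^ n := by simp

/-- CharDial sub-characteristic helper `winCount_le_real` (lens-6 g8 LAND package; see the module docstring). -/
theorem winCount_le_real {n : ℕ} (c : ℕ) (y : Fin (n + 1) → (Fin n → Bool) → Bool) :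
    (winCount c y : ℝ) ≤ (2 : ℝ) ^ n := by
  exact_mod_cast winCount_le c y

/-- **Junta ⊕ linear-form strategy data** (the presentation class of CharDial's `WalkHardFJLinOdd`, item 32604, made
explicit): cut `g` reads a junta `J g` of input bits and ONE `𝔽_p`-linear form `u ↦ Σ_{i : u_i} a g i`, and answers by the
table `h g` (which may depend on `u` only through the bits in `J g` — field `hJ` — and on the form value). -/
structure JLinData (p n : ℕ) where
  /-- the junta of cut `g` -/
  J : Fin (n + 1) → Finset (Fin n)
  /-- the coefficient vector of the linear form of cut `g` -/
  a : Fin (n + 1) → Fin n → ZMod p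
  /-- the answer table of cut `g`: input (seen only on `J g`) and form value ↦ bit -/
  h : Fin (n + 1) → (Fin n → Bool) → ZMod p → Bool
  /-- the table of cut `g` depends on the input only through the bits in `J g` -/
  hJ : ∀ g (u v : Fin n → Bool), (∀ i ∈ J g, u i = v i) → ∀ s, h g u s = h g v s

namespace JLinData

variable {p n : ℕ}

/-- Value of the linear form of cut `g` at input `u`. -/
def form (D : JLinData p n) (g : Fin (n + 1)) (u : Fin n → Bool) : ZMod p := ∑ i, if u i then D.a g i else 0

/-- The strategy presented by the data. -/
def strat (D : JLinData p n) : Fin (n + 1) → (Fin n → Bool) → Bool := fun g u => D.h g u (D.form g u)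

/-- Support of the linear form of cut `g`. -/
def suppForm (D : JLinData p n) (g : Fin (n + 1)) : Finset (Fin n) := univ.filter fun i => D.a g i ≠ 0

/-- Read-set of cut `g`: its junta and the support of its form. -/
def readSet (D : JLinData p n) (g : Fin (n + 1)) : Finset (Fin n) := D.J g ∪ D.suppForm g

/-- **PRIVATE BITS of cut `g`** (the dial of this node): bits in the support of `g`'s form that are neither in `g`'s own
junta nor read (junta or form) by ANY other cut. -/
def privSet (D : JLinData p n) (g : Fin (n + 1)) : Finset (Fin n) :=
  (D.suppForm g).filter fun i => i ∉ D.J g ∧ ∀ g', g' ≠ g → i ∉ D.readSet g'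

/-- The privacy of cut `g` = number of its private bits. -/
def priv (D : JLinData p n) (g : Fin (n + 1)) : ℕ := (D.privSet g).card

/-- The ACTIVE cuts: those whose linear form is not identically zero. -/
def activeSet (D : JLinData p n) : Finset (Fin (n + 1)) := univ.filter fun g => (D.suppForm g).Nonempty

/-- **FREEZING** cut `g` at the residue `κ`: its form is replaced by the constant `κ` (coefficients zeroed, table column
`κ`); every other cut is unchanged. -/
def freeze (D : JLinData p n) (g : Fin (n + 1)) (κ : ZMod p) : JLinData p n where
  J := D.J
  a := fun g' => if g' = g then 0 else D.a g'
  h := fun g' u s => if g' = g then D.h g u κ else D.h g' u s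
  hJ := by
    intro g' u v huv s
    by_cases hg : g' = g
    · rw [if_pos hg, if_pos hg]
      subst hg
      exact D.hJ _ u v huv κ
    · rw [if_neg hg, if_neg hg]
      exact D.hJ g' u v huv s

/-! ### §2 Bookkeeping lemmas: what freezing does to supports, read-sets, privacy and activity -/

/-- CharDial sub-characteristic helper `freeze_J` (lens-6 g8 LAND package; see the module docstring). -/
@[simp] theorem freeze_J (D : JLinData p n) (g : Fin (n + 1)) (κ : ZMod p) : (D.freeze g κ).J = D.J := rfl

/-- CharDial sub-characteristic helper `suppForm_freeze_self` (lens-6 g8 LAND package; see the module docstring). -/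
theorem suppForm_freeze_self (D : JLinData p n) (g : Fin (n + 1)) (κ : ZMod p) :
    (D.freeze g κ).suppForm g = ∅ := by
  ext i
  simp [suppForm, freeze]

/-- CharDial sub-characteristic helper `suppForm_freeze_ne` (lens-6 g8 LAND package; see the module docstring). -/
theorem suppForm_freeze_ne (D : JLinData p n) {g g' : Fin (n + 1)} (hg : g' ≠ g) (κ : ZMod p) :
    (D.freeze g κ).suppForm g' = D.suppForm g' := by
  ext i
  simp [suppForm, freeze, hg]

/-- CharDial sub-characteristic helper `readSet_freeze_subset` (lens-6 g8 LAND package; see the module docstring). -/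
theorem readSet_freeze_subset (D : JLinData p n) (g g' : Fin (n + 1)) (κ : ZMod p) :
    (D.freeze g κ).readSet g' ⊆ D.readSet g' := by
  intro i hi
  unfold readSet at hi ⊢
  rw [freeze_J] at hi
  rcases mem_union.1 hi with h | h
  · exact mem_union.2 (Or.inl h)
  · by_cases hg : g' = g
    · subst hg
      rw [suppForm_freeze_self] at h
      exact absurd h (by simp)
    · rw [suppForm_freeze_ne D hg] at h
      exact mem_union.2 (Or.inr h)

/-- Freezing another cut can only ENLARGE the private set of `g'`. -/
theorem privSet_subset_freeze (D : JLinData p n) {g g' : Fin (n + 1)} (hg : g' ≠ g) (κ : ZMod p) :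
    D.privSet g' ⊆ (D.freeze g κ).privSet g' := by
  intro i hi
  unfold privSet at hi ⊢
  rw [mem_filter] at hi ⊢
  refine ⟨by rw [suppForm_freeze_ne D hg]; exact hi.1, by rw [freeze_J]; exact hi.2.1, fun g'' hg'' h => ?_⟩
  exact hi.2.2 g'' hg'' (readSet_freeze_subset D g g'' κ h)

/-- CharDial sub-characteristic helper `priv_le_priv_freeze` (lens-6 g8 LAND package; see the module docstring). -/
theorem priv_le_priv_freeze (D : JLinData p n) {g g' : Fin (n + 1)} (hg : g' ≠ g) (κ : ZMod p) :
    D.priv g' ≤ (D.freeze g κ).priv g' :=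
  card_le_card (privSet_subset_freeze D hg κ)

/-- CharDial sub-characteristic helper `activeSet_freeze` (lens-6 g8 LAND package; see the module docstring). -/
theorem activeSet_freeze (D : JLinData p n) (g : Fin (n + 1)) (κ : ZMod p) :
    (D.freeze g κ).activeSet = D.activeSet.erase g := by
  ext g'
  unfold activeSet
  rw [mem_erase, mem_filter, mem_filter]
  by_cases hg : g' = g
  · subst hg
    rw [suppForm_freeze_self]
    simp
  · rw [suppForm_freeze_ne D hg]
    simp [hg]

/-- CharDial sub-characteristic helper `card_activeSet_freeze_le` (lens-6 g8 LAND package; see the module docstring). -/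
theorem card_activeSet_freeze_le (D : JLinData p n) {g : Fin (n + 1)} (hg : g ∈ D.activeSet) (κ : ZMod p) {m : ℕ}
    (hm : D.activeSet.card ≤ m + 1) : (D.freeze g κ).activeSet.card ≤ m := by
  rw [activeSet_freeze, card_erase_of_mem hg]
  omega

/-- CharDial sub-characteristic helper `mem_activeSet` (lens-6 g8 LAND package; see the module docstring). -/
theorem mem_activeSet (D : JLinData p n) (g : Fin (n + 1)) : g ∈ D.activeSet ↔ (D.suppForm g).Nonempty := by
  simp [activeSet]

/-- CharDial sub-characteristic helper `card_activeSet_le` (lens-6 g8 LAND package; see the module docstring). -/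
theorem card_activeSet_le (D : JLinData p n) : D.activeSet.card ≤ n + 1 := by
  unfold activeSet
  calc (univ.filter fun g : Fin (n + 1) => (D.suppForm g).Nonempty).card
      ≤ (univ : Finset (Fin (n + 1))).card := card_filter_le _ _
    _ = n + 1 := by simp

/-- CharDial sub-characteristic helper `juntaBound_freeze` (lens-6 g8 LAND package; see the module docstring). -/
theorem juntaBound_freeze (D : JLinData p n) {m : ℕ} (h : (∀ g, (D.J g).card ≤ m)) (g : Fin (n + 1)) (κ : ZMod p) :
    (∀ g', ((D.freeze g κ).J g').card ≤ m) := fun g' => by rw [freeze_J]; exact h g'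

/-- A cut with identically-zero form has form value `0`. -/
theorem form_eq_zero_of_suppForm (D : JLinData p n) {g : Fin (n + 1)} (hg : D.suppForm g = ∅) (u : Fin n → Bool) :
    D.form g u = 0 := by
  unfold form
  refine sum_eq_zero fun i _ => ?_
  have ha : D.a g i = 0 := by
    by_contra h
    have : i ∈ D.suppForm g := by unfold suppForm; exact mem_filter.2 ⟨mem_univ _, h⟩
    rw [hg] at this
    exact absurd this (by simp)
  simp [ha]

/-- **A totally frozen strategy is a junta strategy**: if no cut is active, cut `g` depends only on the bits in `J g`. -/
theorem strat_dependsOn_of_inactive (D : JLinData p n) (hD : D.activeSet = ∅) (g : Fin (n + 1))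
    (u v : Fin n → Bool) (huv : ∀ i ∈ D.J g, u i = v i) : D.strat g u = D.strat g v := by
  have hg : D.suppForm g = ∅ := by
    by_contra h
    have hne : (D.suppForm g).Nonempty := nonempty_iff_ne_empty.2 h
    have : g ∈ D.activeSet := (mem_activeSet D g).2 hne
    rw [hD] at this
    exact absurd this (by simp)
  unfold strat
  rw [form_eq_zero_of_suppForm D hg, form_eq_zero_of_suppForm D hg]
  exact D.hJ g u v huv 0

end JLinData

open JLinData

/-! ### §5 The peeling induction (kernel) -/

section Peel

variable {p : ℕ} {n : ℕ}

/-- **Peel-to-core**: if one cut can always be frozen at cost `C·ρ^{priv}·2ⁿ` and every `L`-core with juntas `≤ m₀`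
wins at most `θ₁·2ⁿ`, then any data with at most `m` active cuts and juntas `≤ m₀` wins at most
`(m·C·ρ^L + θ₁)·2ⁿ` — freeze a cut with `≥ L` private bits while there is one (privacy of the others only grows). -/
theorem peel_to_core (c : ℕ) {C ρ : ℝ} (hC : 0 ≤ C) (hρ0 : 0 ≤ ρ) (hρ1 : ρ ≤ 1)
    (hstep : ∀ (D : JLinData p n) (g : Fin (n + 1)),
      ∃ κ : ZMod p, (winCount c D.strat : ℝ) ≤ C * ρ ^ D.priv g * (2 : ℝ) ^ n + (winCount c (D.freeze g κ).strat : ℝ))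
    (L m₀ : ℕ) (θ₁ : ℝ)
    (hcore : ∀ D : JLinData p n, (∀ g, (D.J g).card ≤ m₀) → (∀ g, (D.suppForm g).Nonempty → D.priv g < L) → (winCount c D.strat : ℝ) ≤ θ₁ * (2 : ℝ) ^ n) :
    ∀ (m : ℕ) (D : JLinData p n), (∀ g, (D.J g).card ≤ m₀) → D.activeSet.card ≤ m →
      (winCount c D.strat : ℝ) ≤ ((m : ℝ) * (C * ρ ^ L) + θ₁) * (2 : ℝ) ^ n := by
  have hCρ : 0 ≤ C * ρ ^ L := mul_nonneg hC (pow_nonneg hρ0 L)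
  have h2n : (0 : ℝ) < (2 : ℝ) ^ n := by positivity
  intro m
  induction m with
  | zero =>
    intro D hJ hm
    have hcoreD : (∀ g, (D.suppForm g).Nonempty → D.priv g < L) := by
      intro g hg
      have : g ∈ D.activeSet := (mem_activeSet D g).2 hg
      have h0 : D.activeSet = ∅ := card_eq_zero.1 (Nat.le_zero.1 hm)
      rw [h0] at this
      exact absurd this (by simp)
    have := hcore D hJ hcoreD
    simpa using this
  | succ m ih =>
    intro D hJ hm
    by_cases hcoreD : (∀ g, (D.suppForm g).Nonempty → D.priv g < L)
    · have h1 := hcore D hJ hcoreD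
      have : θ₁ * (2 : ℝ) ^ n ≤ (((m + 1 : ℕ) : ℝ) * (C * ρ ^ L) + θ₁) * (2 : ℝ) ^ n := by
        have : (0 : ℝ) ≤ ((m + 1 : ℕ) : ℝ) * (C * ρ ^ L) := mul_nonneg (by positivity) hCρ
        nlinarith
      exact h1.trans this
    · -- some active cut has at least `L` private bits: freeze it
      push Not at hcoreD
      obtain ⟨g, hg, hL⟩ := hcoreD
      obtain ⟨κ, hκ⟩ := hstep D g
      have hρL : ρ ^ D.priv g ≤ ρ ^ L := pow_le_pow_of_le_one hρ0 hρ1 hL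
      have hD' := ih (D.freeze g κ) (juntaBound_freeze D hJ g κ)
        (card_activeSet_freeze_le D ((mem_activeSet D g).2 hg) κ hm)
      have hstep' : C * ρ ^ D.priv g * (2 : ℝ) ^ n ≤ C * ρ ^ L * (2 : ℝ) ^ n := by
        have := mul_le_mul_of_nonneg_left hρL hC
        nlinarith
      calc (winCount c D.strat : ℝ)
          ≤ C * ρ ^ D.priv g * (2 : ℝ) ^ n + (winCount c (D.freeze g κ).strat : ℝ) := hκ
        _ ≤ C * ρ ^ L * (2 : ℝ) ^ n + (((m : ℕ) : ℝ) * (C * ρ ^ L) + θ₁) * (2 : ℝ) ^ n := add_le_add hstep' hD'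
        _ = (((m + 1 : ℕ) : ℝ) * (C * ρ ^ L) + θ₁) * (2 : ℝ) ^ n := by push_cast; ring

/-- **Peel-to-nothing** (the exclusive rung): if every active cut owns `≥ L` private bits, peeling never gets stuck and
ends in a junta strategy. -/
theorem peel_exclusive (c : ℕ) {C ρ : ℝ} (hC : 0 ≤ C) (hρ0 : 0 ≤ ρ) (hρ1 : ρ ≤ 1)
    (hstep : ∀ (D : JLinData p n) (g : Fin (n + 1)),
      ∃ κ : ZMod p, (winCount c D.strat : ℝ) ≤ C * ρ ^ D.priv g * (2 : ℝ) ^ n + (winCount c (D.freeze g κ).strat : ℝ))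
    (L m₀ : ℕ) (θ₁ : ℝ)
    (hjunta : ∀ D : JLinData p n, (∀ g, (D.J g).card ≤ m₀) → D.activeSet = ∅ → (winCount c D.strat : ℝ) ≤ θ₁ * (2 : ℝ) ^ n) :
    ∀ (m : ℕ) (D : JLinData p n), (∀ g, (D.J g).card ≤ m₀) → (∀ g, (D.suppForm g).Nonempty → L ≤ D.priv g) → D.activeSet.card ≤ m →
      (winCount c D.strat : ℝ) ≤ ((m : ℝ) * (C * ρ ^ L) + θ₁) * (2 : ℝ) ^ n := by
  have hCρ : 0 ≤ C * ρ ^ L := mul_nonneg hC (pow_nonneg hρ0 L)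
  have h2n : (0 : ℝ) < (2 : ℝ) ^ n := by positivity
  intro m
  induction m with
  | zero =>
    intro D hJ _ hm
    have h0 : D.activeSet = ∅ := card_eq_zero.1 (Nat.le_zero.1 hm)
    have := hjunta D hJ h0
    simpa using this
  | succ m ih =>
    intro D hJ hex hm
    by_cases h0 : D.activeSet = ∅
    · have h1 := hjunta D hJ h0
      have : θ₁ * (2 : ℝ) ^ n ≤ (((m + 1 : ℕ) : ℝ) * (C * ρ ^ L) + θ₁) * (2 : ℝ) ^ n := by
        have : (0 : ℝ) ≤ ((m + 1 : ℕ) : ℝ) * (C * ρ ^ L) := mul_nonneg (by positivity) hCρ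
        nlinarith
      exact h1.trans this
    · obtain ⟨g, hg⟩ := nonempty_iff_ne_empty.2 h0
      have hga : (D.suppForm g).Nonempty := (mem_activeSet D g).1 hg
      have hL : L ≤ D.priv g := hex g hga
      obtain ⟨κ, hκ⟩ := hstep D g
      have hρL : ρ ^ D.priv g ≤ ρ ^ L := pow_le_pow_of_le_one hρ0 hρ1 hL
      have hex' : (∀ g', ((D.freeze g κ).suppForm g').Nonempty → L ≤ (D.freeze g κ).priv g') := by
        intro g' hg'
        by_cases hgg : g' = g
        · subst hgg
          rw [suppForm_freeze_self] at hg'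
          exact absurd hg' (by simp)
        · rw [suppForm_freeze_ne D hgg] at hg'
          exact (hex g' hg').trans (priv_le_priv_freeze D hgg κ)
      have hD' := ih (D.freeze g κ) (juntaBound_freeze D hJ g κ) hex' (card_activeSet_freeze_le D hg κ hm)
      have hstep' : C * ρ ^ D.priv g * (2 : ℝ) ^ n ≤ C * ρ ^ L * (2 : ℝ) ^ n := by
        have := mul_le_mul_of_nonneg_left hρL hC
        nlinarith
      calc (winCount c D.strat : ℝ)
          ≤ C * ρ ^ D.priv g * (2 : ℝ) ^ n + (winCount c (D.freeze g κ).strat : ℝ) := hκ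
        _ ≤ C * ρ ^ L * (2 : ℝ) ^ n + (((m : ℕ) : ℝ) * (C * ρ ^ L) + θ₁) * (2 : ℝ) ^ n := add_le_add hstep' hD'
        _ = (((m + 1 : ℕ) : ℝ) * (C * ρ ^ L) + θ₁) * (2 : ℝ) ^ n := by push_cast; ring

end Peel

/-! ### §6 The asymptotic bookkeeping: `(n+1)·C·q^{log₂ n} → 0` for `q ≤ 1/4` -/

/-- For `0 ≤ q ≤ 1/4`: `(n + 1)·n·q^{⌊log₂ n⌋} ≤ 4`. -/
theorem succ_mul_mul_pow_log_le (q : ℝ) (hq0 : 0 ≤ q) (hq : q ≤ 1 / 4) (n : ℕ) :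
    ((n : ℝ) + 1) * n * q ^ (Nat.log 2 n) ≤ 4 := by
  set k := Nat.log 2 n with hk
  have hlt : n < 2 ^ (k + 1) := Nat.lt_pow_succ_log_self one_lt_two n
  have hnat : (n + 1) * n ≤ 4 ^ k * 4 := by
    calc (n + 1) * n ≤ 2 ^ (k + 1) * 2 ^ (k + 1) := Nat.mul_le_mul hlt hlt.le
      _ = 4 ^ k * 4 := by rw [← mul_pow, pow_succ]; norm_num
  have hreal : ((n : ℝ) + 1) * n ≤ (4 : ℝ) ^ k * 4 := by exact_mod_cast hnat
  have hqk : q ^ k ≤ (1 / 4 : ℝ) ^ k := pow_le_pow_left₀ hq0 hq k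
  have h4k : (4 : ℝ) ^ k * (1 / 4 : ℝ) ^ k = 1 := by rw [← mul_pow]; norm_num
  have hqk0 : 0 ≤ q ^ k := pow_nonneg hq0 k
  have hn0 : (0 : ℝ) ≤ ((n : ℝ) + 1) * n := by positivity
  calc ((n : ℝ) + 1) * n * q ^ k ≤ ((n : ℝ) + 1) * n * (1 / 4 : ℝ) ^ k := mul_le_mul_of_nonneg_left hqk hn0
    _ ≤ (4 : ℝ) ^ k * 4 * (1 / 4 : ℝ) ^ k := mul_le_mul_of_nonneg_right hreal (pow_nonneg (by norm_num) k)
    _ = 4 := by rw [mul_assoc, mul_comm 4, ← mul_assoc, h4k, one_mul]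

/-- The peeling error `(n+1)·C·q^{log₂ n}` is eventually below any `ε > 0` (for `q ≤ 1/4`). -/
theorem peel_error_small (C ε q : ℝ) (hC : 0 ≤ C) (hε : 0 < ε) (hq0 : 0 ≤ q) (hq : q ≤ 1 / 4) :
    ∃ n₁ : ℕ, ∀ n ≥ n₁, ((n : ℝ) + 1) * C * q ^ (Nat.log 2 n) ≤ ε := by
  refine ⟨⌈4 * C / ε⌉₊ + 1, fun n hn => ?_⟩
  have hn1' : 1 ≤ n := le_trans (Nat.le_add_left 1 _) hn
  have hn1 : (1 : ℝ) ≤ n := by exact_mod_cast hn1'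
  have hnpos : (0 : ℝ) < n := by linarith
  have hceil : 4 * C / ε ≤ n := by
    have h1 : (⌈4 * C / ε⌉₊ : ℝ) ≤ n := by
      have : (⌈4 * C / ε⌉₊ : ℕ) ≤ n := le_trans (Nat.le_succ _) hn
      exact_mod_cast this
    exact (Nat.le_ceil _).trans h1
  have h4 := succ_mul_mul_pow_log_le q hq0 hq n
  -- `(n+1) q^k ≤ 4 / n`, so `(n+1) C q^k ≤ 4C/n ≤ ε`
  have hmain : ((n : ℝ) + 1) * q ^ (Nat.log 2 n) * n ≤ 4 := by nlinarith
  have h5 : ((n : ℝ) + 1) * C * q ^ (Nat.log 2 n) * n ≤ 4 * C := by nlinarith [pow_nonneg hq0 (Nat.log 2 n)]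
  have h6 : 4 * C ≤ ε * n := by
    have := (div_le_iff₀ hε).1 hceil
    linarith
  nlinarith [pow_nonneg hq0 (Nat.log 2 n)]

end Summit.QuantumAdvantage.AdviceFreeQNC0.JLinPeel
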